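import Summits.CriticalPhenomena.Ising3DConformalLimit.Theses.PrecisionLaplacian
import Literature.MathematicalPhysics.QuantumFieldTheory.MirrorRPKernel
import Literature.MathematicalPhysics.QuantumFieldTheory.LatticeMirrorNormals
import HarnessLib.Audit

/-!
# Line `cross-theorem-analyticity` — crux `PrecisionLaplacian.StableConeRPRigidity` (stmt-CriticalPhenomena-4800)

Skeleton (crux-plan, round 1; idea card `Ideas/cross-theorem-analyticity.md`, triage TRIAGE-r1-{1,2,3}: pass ×3,
"the LOCAL rung of the entire-profile line"; this file turns it into a concluding line whose distinctive half is
several complex variables).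

CRUX (by name): `Summit.CriticalPhenomena.Ising3DConformalLimit.Theses.PrecisionLaplacian.StableConeRPRigidity` —
a positive continuous kernel `K` on `ℝ³ ∖ 0`, homogeneous of degree `α - 3` (`1 ≤ α < 2`), the potential kernel of
the symmetric `α`-stable law with angular Lévy density `Φ`, invariant and reflection positive in the nine lattice
mirrors `eᵢ, eᵢ ± eⱼ`, is `O(3)`-invariant.  Throughout `β := 3 - α ∈ (1, 2]` is minus the degree of `K`.

THE LINE (K-side, Fourier-free; `Φ` and the potential equation enter only the closer S4).
* S1 `stub_halfPlaneExtension` — ONE FIN PER MIRROR.  Reflection positivity in the mirror `n` plus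
  `θ_n`-invariance, continuity and homogeneity of negative degree make `k(t, x') = K(t n̂ + x')` a continuous
  positive-definite function on the `*`-semigroup `(0,∞) × n^⊥` (involution `(t,x')* = (t,-x')`), hence a
  Laplace–Fourier transform `∫ e^{-λt} e^{i⟨q,x'⟩} dμ_n` (Osterwalder–Schrader / Widder–Bernstein in `t`,
  Bochner transversally; BCR 1984 §4.2–4.4, FILS 1978 §2–3, Glimm–Jaffe §6.2).  Output, stated without measures:
  for every real `y` the normal variable extends holomorphically, `ζ ↦ K(y + ζ n̂)` on `{Re ζ > -⟨y,n̂⟩}`, jointly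
  continuously, with the DOMINATION BOUND `|K(y + ζ n̂)| ≤ K((Re ζ + ⟨y,n̂⟩) n̂)` (`HalfPlaneExtension n K`).
  The nine fins are the 4-real-dimensional sets `{x + iτ n̂}` of Disproof §G; no transverse variable is complex yet.
* S2 `stub_bernsteinCross` — THE LEVER (pure SCV, Bernstein–Siciak bounded cross theorem, `N = 3`, local cube form):
  a function on a real cube each of whose coordinate slices through every point of the cube extends holomorphically
  and uniformly boundedly to the disc on the cube's edge is the restriction of ONE holomorphic function of three
  complex variables on a complex cube of proportional size, with the same bound (two-constants theorem with equal
  constants).  Siciak 1969 (Ann. Polon. Math. 22), Bernstein 1912 (N = 2); Jarnicki–Pflug, EMS Tracts 16, §5.4.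
  NOT Osgood (`Literature.Analysis.Complex.SCV.differentiableOn_of_continuousOn_of_separately` needs the function
  already defined at points with two complex coordinates — triage r1-2's objection, honoured).
* S3 `stub_grauertTube` — SEPARATE ⇒ JOINT with a UNIVERSAL GRAUERT RADIUS: at every `x ≠ 0` the lattice normals
  with `⟨x,n⟩ ≠ 0` span `ℝ³` (`span_latticeMirrorNormals_inner_ne_zero`, proved in tree; false for the three
  coordinate normals alone), so three independent fins cross at `x`; in the linear coordinates of such a triple S2
  applies (moving half-plane fibres contain fixed discs near `x`), giving a jointly holomorphic extension near `x`;
  compactness of the sphere and real homogeneity glue these into a holomorphic extension of `K` to the conic tube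
  `{z ∈ ℂ³ : ‖Im z‖ < c‖Re z‖}` with `|K(z)| ≤ C ‖Re z‖^{-β}` (`TubeExtension β K`).  This is the card's
  `NineMirrorAnalyticity` in its quantitative form (= Disproof §G "LOCAL step is fine", §P(iii) milestone; HRP2
  Disproof F7), and it already covers BOTH uncovered lines of every meridian profile near the real circle.
* S4 `stub_meridianGapPinning` — THE CLOSER (hardest; the card's Transfer `C⁺`, = `(E₉)` of card
  entire-profile-null-growth at ONE pole): under the crux hypotheses, given the nine fins and the tube, for every
  unit `u ⊥ e₁` the meridian profile `ω ↦ K(cos ω u + sin ω e₁)` is the restriction of an ENTIRE function of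
  exponential type `≤ β` in `|Im ω|`.  A priori (S1 + S3 + homogeneity) it is holomorphic off the two lines
  `Re ω ∈ (π/2)ℤ` and on `{|Im ω| < artanh c}`; in the variable `t = tan ω` the unknown singular set is the pair of
  COMPACT slits `±i[c, 1/c]` through the null points `±i`; one orthonormal triple of fins already shrinks them to
  `c(u) = max(|cos φ|, |sin φ|) ≥ 1/√2` (triage r1-3), and they are EMPTY on the seven web circles (Disproof §L).
  Engines, in order: (a) envelope of holomorphy of the `B₃ × ℝ₊`-invariant nine-fin domain (iterated crosses over
  the 68 independent normal triples with two-constants growth transport; every ALGEBRAIC obstruction is excluded by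
  Disproof §T, and the quadric obstructions `1/(zᵀAz + c)` die unless `A = λI`, triage r1-2); (b) where (a) stalls
  (Disproof §G predicts it does, away from the real sphere), threshold pinning `t_*(e₁,u) ≡ 1` by the positivity of
  the Nevanlinna/Källén–Lehmann jump measures across the slits, real-analytic in `u`, vanishing at the web
  directions — the second-variation template of Disproof §V is the first instance.  RP is therefore KEPT among the
  hypotheses (no positivity-free envelope claim is made a stub: honouring §G and triage r1-1/r1-2).
* S5 `stub_fourierExtinction` — ENTIRE PROFILES ⇒ ISOTROPY (one-variable): an entire `π`-periodic even profile of type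
  `≤ β` has Fourier modes `e^{2imω}` only for `2|m| ≤ β` (contour shift / Laurent–Cauchy estimate in `q = e^{2iω}`);
  for `β < 2` every profile through `e₁` is constant, for `β = 2` the surviving quadrupole `cos 2ω` is killed by the
  quarter-turn `θ_{e₁-e₂} ∘ θ_{e₁}` of the coordinate circles (all nine invariances available); so `K ≡ K(e₁)` on
  `S²`, `K = K(e₁)‖x‖^{-β}`, `O(3)`-invariant.
The composition `StableConeRPRigidity_of : S1 → S2 → S3 → S4 → S5 → StableConeRPRigidity` is PROVED below (pure
logic: `β := 3 - α`, the crux's inlined mirror/RP clauses are `latticeMirrorNormals (Fin 3)` / `IsMirrorRPKernel`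
by `Iff.rfl`).

DISPROOF USED (`Cruxes/StableConeRPRigidity/Disproof.lean`, gen 2 v2, read 2026-08-16; no `Negative/` lemma landed):
* `not_invarianceOnlyRigidity` (RP load-bearing; the refuted strengthening `InvarianceOnlyRigidity`): honoured —
  RP enters at S1 (the fins exist only because of RP: the witness `Σxₖ⁴/‖x‖⁶` has NO half-plane extension with the
  domination bound) and again at S4; no stub concludes isotropy from invariance + regularity alone (S5 assumes
  ENTIRE profiles of controlled type, which the quartic witness lacks: its profile `cos⁴ω + …` has type 4 > β).
* `of_HRP2Rigidity` / §W: S1–S3 and S5 are stated for general degree `-β` (they are true at that generality);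
  ONLY S4 carries `Φ`, the potential equation and `1 ≤ α < 2` verbatim, so S4 is crux-strength, not
  1979-strength (a Δ = 1 counterexample to item 1979 outside the stable cone — HRP2 Disproof F8/F11 hunt there —
  would not kill this line).  `α < 2` (⇔ `β > 1`) is used nowhere else; `1 ≤ α` (⇔ `β ≤ 2`) is what S5 needs.
* §G (no tube/Hartogs engine off the fins far from the real sphere): honoured by keeping RP in S4 and by making the
  uncontroversial local statement (S3) a separate stub; §L (seven-plane lemma) and §V (second variation) are the
  K-side inputs S4's engine (b) starts from; §T removes the algebraic sector of S4's possible obstructions.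
* `rp_pair_bound` (m = 2 shadow): not sufficient for anything here (HRP2 Disproof: `m ≤ 2` never forces isotropy);
  S1 uses all `m` (it IS the GNS construction).
Dead lines: none recorded on the item (round 1).

Namespace `…Cruxes.StableConeRPRigidity.CrossTheoremAnalyticity`.  Conventions as in the accepted skeletons of
`Cruxes/GapForcesFarMerging/Lines/`: each stub statement is a plain `def … : Prop`; the REGISTERED stubs are the
sorried `theorem stub_…` (statement unfolded one level); the name-keyed aliases `Registered.stub_…` are the
hypotheses of `StableConeRPRigidity_of`.
-/

noncomputable section

namespace Summit.CriticalPhenomena.Ising3DConformalLimit.Cruxes.StableConeRPRigidity.CrossTheoremAnalyticity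

open scoped InnerProductSpace
open Literature.MathematicalPhysics.QuantumFieldTheory

/-! ## Vocabulary (tree declarations only) -/

/-- Ambient space `ℝ³`. -/
abbrev E := EuclideanSpace ℝ (Fin 3)

/-- The pole `e₁ = (1,0,0)` used by the closer (any coordinate pole would do, by `B₃`). -/
abbrev e₁ : E := EuclideanSpace.single 0 (1 : ℝ)

/-- The real point `x ∈ ℝ³` seen in `ℂ³`. -/
def cplx (x : E) : Fin 3 → ℂ := fun i => ((x i : ℝ) : ℂ)

/-- The conic tube `{z ∈ ℂ³ : ‖Im z‖ < c ‖Re z‖}` (it contains `ℝ³ ∖ 0` and no point with `Re z = 0`). -/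
def coneTube (c : ℝ) : Set (Fin 3 → ℂ) :=
  {z | ∑ i, (z i).im ^ 2 < c ^ 2 * ∑ i, (z i).re ^ 2}

/-- **Output of S1 — the fin of the mirror `n`.**  Writing `n̂ = ‖n‖⁻¹ n`: a function `G ζ y` ("`K(y + ζ n̂)`"),
holomorphic in `ζ` on the half-plane `{Re ζ > -⟨y, n̂⟩}` for every real `y`, jointly continuous, equal to
`K(y + t n̂)` for real `t` in that half-line, and DOMINATED by the axis values:
`‖G ζ y‖ ≤ K((Re ζ + ⟨y,n̂⟩) n̂)` (from `|∫ e^{-ζλ+iq·y'} dμ| ≤ ∫ e^{-(Re ζ)λ} dμ`). -/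
def HalfPlaneExtension (n : E) (K : E → ℝ) : Prop :=
  ∃ G : ℂ → E → ℂ,
    (∀ y : E, DifferentiableOn ℂ (fun ζ => G ζ y) {ζ : ℂ | 0 < ζ.re + ⟪y, ‖n‖⁻¹ • n⟫_ℝ}) ∧
    ContinuousOn (fun p : ℂ × E => G p.1 p.2) {p | 0 < p.1.re + ⟪p.2, ‖n‖⁻¹ • n⟫_ℝ} ∧
    (∀ (y : E) (t : ℝ), 0 < t + ⟪y, ‖n‖⁻¹ • n⟫_ℝ → G t y = ((K (y + t • ‖n‖⁻¹ • n) : ℝ) : ℂ)) ∧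
    (∀ (y : E) (ζ : ℂ), 0 < ζ.re + ⟪y, ‖n‖⁻¹ • n⟫_ℝ →
      ‖G ζ y‖ ≤ K ((ζ.re + ⟪y, ‖n‖⁻¹ • n⟫_ℝ) • ‖n‖⁻¹ • n))

/-- **Output of S3 — the uniform Grauert tube.**  `K` extends to a holomorphic function on a conic tube
`coneTube c`, `c > 0`, with the power bound `‖F z‖ ≤ C ‖Re z‖^{-β}`. -/
def TubeExtension (β : ℝ) (K : E → ℝ) : Prop :=
  ∃ c C : ℝ, 0 < c ∧ ∃ F : (Fin 3 → ℂ) → ℂ, DifferentiableOn ℂ F (coneTube c) ∧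
    (∀ x : E, x ≠ 0 → F (cplx x) = ((K x : ℝ) : ℂ)) ∧
    ∀ z ∈ coneTube c, ‖F z‖ ≤ C * (∑ i, (z i).re ^ 2) ^ (-β / 2)

/-- **Output of S4 — entire meridian profiles through the pole `e₁`** (`(E₉)` of card entire-profile-null-growth at
one pole, in the checkable one-variable form of `SketchIdeator1.NineSlabEntireProfiles`): for every unit `u ⊥ e₁`
the profile `ω ↦ K(cos ω u + sin ω e₁)` is the restriction of an entire function of exponential type `≤ β`. -/
def EntireMeridianProfiles (β : ℝ) (K : E → ℝ) : Prop :=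
  ∀ u : E, ‖u‖ = 1 → ⟪u, e₁⟫_ℝ = 0 →
    ∃ g : ℂ → ℂ, Differentiable ℂ g ∧
      (∀ ω : ℝ, g ω = ((K (Real.cos ω • u + Real.sin ω • e₁) : ℝ) : ℂ)) ∧
      ∃ C : ℝ, ∀ ω : ℂ, ‖g ω‖ ≤ C * Real.exp (β * |ω.im|)

/-! ## S1 — one fin per mirror (Laplace–Fourier representation; size M) -/

/-- **S1 `HalfPlaneExtensionLemma`.**  For a normal `n ≠ 0` and a kernel `K` continuous on `ℝ³ ∖ 0`, homogeneous
of NEGATIVE degree `-β` (this supplies boundedness on `{⟨x,n̂⟩ ≥ t₀}`, so the OS shift semigroup is contractive —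
triage r1-3's local-boundedness remark; Widder's theorem for exponentially convex functions would remove it),
EVEN and `θ_n`-invariant (together: `K(t n̂ + x') = K(t n̂ - x')`, so the Gram matrices `K(p_a - θ p_b)` are
symmetric — without evenness RP is blind to the transversally odd part of `K`, e.g. `‖x‖^{-β} + ε⟨x,w⟩‖x‖^{-β-1}`,
`w ⊥ n`, is RP and `θ_n`-invariant but violates the domination bound) and mirror-RP (`IsMirrorRPKernel n K`,
literally the crux's clause), the fin exists.
Proof route: GNS space of finitely supported functions on the open half-space with `⟨F,G⟩ = Σ c_a d_b K(p_a - θ p_b)`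
(symmetric by evenness + `θ_n`-invariance, `mirrorKernel_symm_of_even`, so the real RP form controls complex
coefficients too); shifts along `n̂` = positive contraction semigroup, transverse translations = unitary group; `Literature.Analysis.OperatorTheory.IsEnergyMomentumPair.exists_measure_inner_transfer_translate_eq_integral`
(PROVED in tree: matrix elements are `∫ e^{-tp⁰ + i⟨a,p⟩} dμ`) applied to `ψ = δ_{y}`-type vectors after the
`t ↦ t/2` bookkeeping; holomorphy/continuity/domination by dominated convergence.  BergChristensenRessel1984
Thm 4.2.8 & §4.4; FrohlichIsraelLiebSimon1978 §2–3; GlimmJaffe1987 Thm 6.1.3 / §6.2. -/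
def HalfPlaneExtensionLemma : Prop :=
  ∀ (n : E) (K : E → ℝ) (β : ℝ), n ≠ 0 → 0 < β → ContinuousOn K {0}ᶜ → (∀ x, K (-x) = K x) →
    (∀ c : ℝ, 0 < c → ∀ x, K (c • x) = c ^ (-β) * K x) →
    (∀ x, K ((ℝ ∙ n)ᗮ.reflection x) = K x) → IsMirrorRPKernel n K →
    HalfPlaneExtension n K

/-- Registered stub S1 (statement = `HalfPlaneExtensionLemma`, unfolded one level). -/
theorem stub_halfPlaneExtension :
    ∀ (n : E) (K : E → ℝ) (β : ℝ), n ≠ 0 → 0 < β → ContinuousOn K {0}ᶜ → (∀ x, K (-x) = K x) →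
      (∀ c : ℝ, 0 < c → ∀ x, K (c • x) = c ^ (-β) * K x) →
      (∀ x, K ((ℝ ∙ n)ᗮ.reflection x) = K x) → IsMirrorRPKernel n K →
      HalfPlaneExtension n K := by
  sorry

/-! ## S2 — the bounded cross theorem, `N = 3`, local cube form (pure SCV; size L) -/

/-- **S2 `BoundedCrossLemma`** (Bernstein–Siciak, bounded case).  There is `ρ = κ·r` (`κ` absolute) such that:
if `f : ℝ³ → ℂ` and, for EVERY point `x` of the open cube `Q(x₀,r)` and every coordinate `i`, the slice
`s ↦ f(update x i s)` on the edge interval `|s - x₀ᵢ| < r` is the trace of a holomorphic `φ` on the disc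
`B(x₀ᵢ, r) ⊂ ℂ` with `‖φ‖ ≤ M`, then `f` is the trace of ONE holomorphic `F` on the complex cube
`{‖zⱼ - x₀ⱼ‖ < ρ}` with `‖F‖ ≤ M`.  This is the cross `X = ⋃ᵢ A₁ × … × Dᵢ × … × A₃`, `Aⱼ = Dⱼ ∩ ℝ` the
diameter of the disc `Dⱼ`: `f` extends to the hull `{Σⱼ h_{Aⱼ,Dⱼ}(zⱼ) < 1}` (relative extremal functions) with
the two-constants bound `M^{1-Σh} M^{Σh} = M`, and the hull contains a concentric complex cube (scale invariance
gives `ρ ∝ r`).  No continuity/measurability hypothesis is needed (Siciak); with the joint continuity S1 provides a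
prover may use the older Bernstein–Hartogs series argument (Chebyshev coefficients on `Aⱼ` decay like `M ϱ^{-k}`,
iterate in the other variables, sum on a polyellipse).  Siciak, Ann. Polon. Math. 22 (1969) Thm 2;
Zahariuta, Mat. Sb. 101 (1976); JarnickiPflug2011 (EMS Tracts 16) Thm 5.4.1; Mathlib one-variable tools:
Cauchy estimates, `DifferentiableOn.analyticOnNhd`, identity theorem. -/
def BoundedCrossLemma : Prop :=
  ∀ r : ℝ, 0 < r → ∃ ρ : ℝ, 0 < ρ ∧
    ∀ (f : (Fin 3 → ℝ) → ℂ) (x₀ : Fin 3 → ℝ) (M : ℝ),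
      (∀ (i : Fin 3) (x : Fin 3 → ℝ), (∀ j, |x j - x₀ j| < r) →
        ∃ φ : ℂ → ℂ, DifferentiableOn ℂ φ (Metric.ball ((x₀ i : ℝ) : ℂ) r) ∧
          (∀ s : ℝ, |s - x₀ i| < r → φ s = f (Function.update x i s)) ∧
          ∀ ζ ∈ Metric.ball ((x₀ i : ℝ) : ℂ) r, ‖φ ζ‖ ≤ M) →
      ∃ F : (Fin 3 → ℂ) → ℂ, DifferentiableOn ℂ F {z | ∀ j, ‖z j - ((x₀ j : ℝ) : ℂ)‖ < ρ} ∧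
        (∀ x : Fin 3 → ℝ, (∀ j, |x j - x₀ j| < ρ) → F (fun j => ((x j : ℝ) : ℂ)) = f x) ∧
        ∀ z : Fin 3 → ℂ, (∀ j, ‖z j - ((x₀ j : ℝ) : ℂ)‖ < ρ) → ‖F z‖ ≤ M

/-- Registered stub S2 (statement = `BoundedCrossLemma`, unfolded one level). -/
theorem stub_bernsteinCross :
    ∀ r : ℝ, 0 < r → ∃ ρ : ℝ, 0 < ρ ∧
      ∀ (f : (Fin 3 → ℝ) → ℂ) (x₀ : Fin 3 → ℝ) (M : ℝ),
        (∀ (i : Fin 3) (x : Fin 3 → ℝ), (∀ j, |x j - x₀ j| < r) →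
          ∃ φ : ℂ → ℂ, DifferentiableOn ℂ φ (Metric.ball ((x₀ i : ℝ) : ℂ) r) ∧
            (∀ s : ℝ, |s - x₀ i| < r → φ s = f (Function.update x i s)) ∧
            ∀ ζ ∈ Metric.ball ((x₀ i : ℝ) : ℂ) r, ‖φ ζ‖ ≤ M) →
        ∃ F : (Fin 3 → ℂ) → ℂ, DifferentiableOn ℂ F {z | ∀ j, ‖z j - ((x₀ j : ℝ) : ℂ)‖ < ρ} ∧
          (∀ x : Fin 3 → ℝ, (∀ j, |x j - x₀ j| < ρ) → F (fun j => ((x j : ℝ) : ℂ)) = f x) ∧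
          ∀ z : Fin 3 → ℂ, (∀ j, ‖z j - ((x₀ j : ℝ) : ℂ)‖ < ρ) → ‖F z‖ ≤ M := by
  sorry

/-! ## S3 — separate ⇒ joint: the uniform conic tube (geometry of the nine normals + S2; size M) -/

/-- **S3 `UniformTubeLemma`.**  Assuming the bounded cross theorem (S2): a kernel continuous on `ℝ³ ∖ 0`,
homogeneous of degree `-β < 0`, invariant under the nine lattice mirrors and possessing the nine fins (S1's output
for every `n ∈ latticeMirrorNormals (Fin 3)`; the fins of `-n` follow by `θ_n`-invariance) extends holomorphically
to a conic tube with a power bound.  Proof route: (1) at `x ∈ S²` pick three linearly independent lattice normals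
`m₁,m₂,m₃` with `⟨x,mⱼ⟩ > 0` after sign choice (`span_latticeMirrorNormals_inner_ne_zero`; for `-mⱼ` use
`θ`-invariance); in the coordinates `z = Σ ζⱼ m̂ⱼ` the fin of `mⱼ` makes `ζⱼ ↦ K` holomorphic on the moving
half-plane `{Re ζⱼ > -Σ_{k≠j} ζₖ⟨m̂ₖ,m̂ⱼ⟩}`, which contains a fixed disc about `ζⱼ(x)` for `ζ` in a small real cube;
the domination bound gives `M = sup K(t m̂ⱼ)` over a compact `t`-range; S2 yields a holomorphic extension on a
complex cube, i.e. near `x` after the `ℂ`-linear change of variables; (2) finitely many cubes cover `S²`; local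
pieces agree on overlaps (conjugation-symmetric convex overlaps contain real points; identity theorem), giving `F₁`
on `{|‖Re z‖ - 1| < δ, ‖Im z‖ < c}`; (3) `F(z) := ‖Re z‖^{-β} F₁(z/‖Re z‖)` is holomorphic on `coneTube c` because
it coincides locally with the transported local extensions (real homogeneity `K(λx) = λ^{-β}K(x)` propagates to the
extensions by uniqueness), and `‖F z‖ ≤ (sup|F₁|) ‖Re z‖^{-β}`. -/
def UniformTubeLemma : Prop :=
  BoundedCrossLemma →
    ∀ (β : ℝ) (K : E → ℝ), 0 < β → ContinuousOn K {0}ᶜ →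
      (∀ c : ℝ, 0 < c → ∀ x, K (c • x) = c ^ (-β) * K x) →
      (∀ n ∈ latticeMirrorNormals (Fin 3), ∀ x, K ((ℝ ∙ n)ᗮ.reflection x) = K x) →
      (∀ n ∈ latticeMirrorNormals (Fin 3), HalfPlaneExtension n K) →
      TubeExtension β K

/-- Registered stub S3 (statement = `UniformTubeLemma`, unfolded one level). -/
theorem stub_grauertTube :
    BoundedCrossLemma →
      ∀ (β : ℝ) (K : E → ℝ), 0 < β → ContinuousOn K {0}ᶜ →
        (∀ c : ℝ, 0 < c → ∀ x, K (c • x) = c ^ (-β) * K x) →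
        (∀ n ∈ latticeMirrorNormals (Fin 3), ∀ x, K ((ℝ ∙ n)ᗮ.reflection x) = K x) →
        (∀ n ∈ latticeMirrorNormals (Fin 3), HalfPlaneExtension n K) →
        TubeExtension β K := by
  sorry

/-! ## S4 — the closer: meridian gap pinning (`C⁺` of the card = `(E₉)` at the pole `e₁`; size XL, OPEN) -/

/-- **S4 `MeridianGapPinning`** — the hardest stub.  Under the crux's hypotheses VERBATIM (so this stub is
crux-strength: it follows from the crux's conclusion, constant profiles being entire of type 0), and given the
nine fins (S1) and the uniform tube (S3), every meridian profile through `e₁` is entire of exponential type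
`≤ 3 - α`.  What is known at the start of the proof, per unit `u ⊥ e₁` and in `t = tan ω`:
`H_u(t) := (1+t²)^{β/2} K(u + t e₁)` is holomorphic and single-valued on `ℂ̂ ∖ ±i[c(u), 1/c(u)]`
(fins: `Re t ≠ 0`; tube: `|Im t| < c` and, via homogeneity `K(u + te₁) = t^{-β}K(e₁ + u/t)`, `|t| > 1/c`),
with `|H_u| ≲ e^{β|Im ω|}` on the fins (domination bound of S1: `|K(u+te₁)| ≤ (Re t)^{-β}K(e₁)`, transported by
two-constants estimates); one orthonormal triple `{(e₁±e₂)/√2, e₃}` or `{(e₁±e₃)/√2, e₂}` gives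
`c(u) ≥ max(|cos φ|,|sin φ|) ≥ 1/√2` (Siciak hull `{Σ (2/π)|arg zⱼ| < 1}`: `tanh|Im ω| < cos φ`); on the four web
directions `u ∈ {±e₂, ±e₃}` the slits are EMPTY (seven-circle lemma, Disproof §L / card entire-profile-null-growth
(B), K-side margin `β < 4`).  TARGET: the slits are empty for every `u` (equivalently the cut thresholds
`t_*(e₁,u) ≡ 1` of the Stieltjes/CBF sections, triage r1-3).  Engines: (a) envelope of holomorphy of the
`B₃ × ℝ₊`-invariant nine-fin-plus-tube domain (iterated crosses over the 68 independent normal triples; algebraic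
obstructions excluded by Disproof §T); (b) positivity across leaves: the jumps of `H_u` across the slits are the
Källén–Lehmann/Nevanlinna measures of the RP sections (`Im ≥ 0` spacelike, `arg ∈ [-πa, π-πa]` timelike,
`a = α/2`), real-analytic in `u` by S3, zero at the web directions; Disproof §V's second variation is the first
term of their Taylor expansion in `u` about the web, and the induction on jets it starts (odd orders have dominance
windows iff `α < 2`) is the planned route, with the transversal Cauchy loss `δ(T) ~ e^{-2|T|}` as the named
obstacle.  WHY EASIER than the crux: one holomorphic function of one variable per leaf with a COMPACT singular set
of known positivity type, an explicit uniform gap, seven exactly known leaves, and uniqueness of continuation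
turning any open set of round leaves into all leaves. -/
def MeridianGapPinning : Prop :=
  ∀ (α : ℝ) (Φ K : E → ℝ), 1 ≤ α → α < 2 → ContinuousOn Φ (Metric.sphere 0 1) →
    (∀ u ∈ Metric.sphere (0 : E) 1, 0 ≤ Φ u) → (∃ u ∈ Metric.sphere (0 : E) 1, 0 < Φ u) →
    (∀ u, Φ (-u) = Φ u) → ContinuousOn K {0}ᶜ → (∀ x, x ≠ 0 → 0 < K x) →
    (∀ c : ℝ, 0 < c → ∀ x, K (c • x) = c ^ (α - 3) * K x) →
    (∀ f : E → ℝ, ContDiff ℝ 2 f → HasCompactSupport f → ∀ x,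
      (∫ y, K (x - y) * ((1/2 : ℝ) * ∫ z, (f (y + z) + f (y - z) - 2 * f y) *
        (‖z‖ ^ (-(3 + α)) * Φ (‖z‖⁻¹ • z)))) = - f x) →
    (∀ n ∈ latticeMirrorNormals (Fin 3),
      (∀ x, K ((ℝ ∙ n)ᗮ.reflection x) = K x) ∧ IsMirrorRPKernel n K) →
    (∀ n ∈ latticeMirrorNormals (Fin 3), HalfPlaneExtension n K) →
    TubeExtension (3 - α) K →
    EntireMeridianProfiles (3 - α) K

/-- Registered stub S4 (statement = `MeridianGapPinning`, unfolded one level). -/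
theorem stub_meridianGapPinning :
    ∀ (α : ℝ) (Φ K : E → ℝ), 1 ≤ α → α < 2 → ContinuousOn Φ (Metric.sphere 0 1) →
      (∀ u ∈ Metric.sphere (0 : E) 1, 0 ≤ Φ u) → (∃ u ∈ Metric.sphere (0 : E) 1, 0 < Φ u) →
      (∀ u, Φ (-u) = Φ u) → ContinuousOn K {0}ᶜ → (∀ x, x ≠ 0 → 0 < K x) →
      (∀ c : ℝ, 0 < c → ∀ x, K (c • x) = c ^ (α - 3) * K x) →
      (∀ f : E → ℝ, ContDiff ℝ 2 f → HasCompactSupport f → ∀ x,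
        (∫ y, K (x - y) * ((1/2 : ℝ) * ∫ z, (f (y + z) + f (y - z) - 2 * f y) *
          (‖z‖ ^ (-(3 + α)) * Φ (‖z‖⁻¹ • z)))) = - f x) →
      (∀ n ∈ latticeMirrorNormals (Fin 3),
        (∀ x, K ((ℝ ∙ n)ᗮ.reflection x) = K x) ∧ IsMirrorRPKernel n K) →
      (∀ n ∈ latticeMirrorNormals (Fin 3), HalfPlaneExtension n K) →
      TubeExtension (3 - α) K →
      EntireMeridianProfiles (3 - α) K := by
  sorry

/-! ## S5 — entire profiles of type `≤ β ≤ 2` + the nine invariances ⇒ isotropy (one variable; size M) -/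

/-- **S5 `ModeExtinction`.**  For `0 < β ≤ 2`, a kernel homogeneous of degree `-β`, invariant under the nine
lattice mirrors, all of whose meridian profiles through `e₁` are entire of type `≤ β`, is `O(3)`-invariant.
Proof route: `g_u(ω+π) = g_u(ω)` (evenness of `K` = `θ_{e₁}θ_{e₂}θ_{e₃}`) and `g_u(-ω) = g_u(ω)` (`θ_{e₁}`), on `ℝ`
hence on `ℂ`; Laurent expansion in `q = e^{2iω}` on `ℂ*` with `|g| ≤ C|q|^{∓β/2}` kills the modes `2|m| > β`
(Cauchy estimate on `|q| = r`, `r → 0, ∞`), so `g_u = A(u) + B(u) cos 2ω` (`B = 0` outright if `β < 2`);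
the coordinate circles `{x₃ = 0}`, `{x₁ = 0}` are meridians of `e₁` resp. `θ_{e₁-e₂}`-images of them and carry the
quarter-turn `θ_{e₁-e₂}∘θ_{e₁}` resp. `θ_{e₂-e₃}∘θ_{e₂}`, which sends `cos 2ω ↦ -cos 2ω`: `K` is constant on them,
so `K(u) = K(e₁)` on the equator `{x₁ = 0}`, whence `B(u) = (K(u) - K(e₁))/2 = 0` and `K ≡ K(e₁)` on `S²`;
homogeneity gives `K x = K(e₁)‖x‖^{-β}` for `x ≠ 0`, and `‖R x‖ = ‖x‖`. -/
def ModeExtinction : Prop :=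
  ∀ (β : ℝ) (K : E → ℝ), 0 < β → β ≤ 2 →
    (∀ c : ℝ, 0 < c → ∀ x, K (c • x) = c ^ (-β) * K x) →
    (∀ n ∈ latticeMirrorNormals (Fin 3), ∀ x, K ((ℝ ∙ n)ᗮ.reflection x) = K x) →
    EntireMeridianProfiles β K →
    ∀ (R : E ≃ₗᵢ[ℝ] E) (x : E), K (R x) = K x

/-- Registered stub S5 (statement = `ModeExtinction`, unfolded one level). -/
theorem stub_fourierExtinction :
    ∀ (β : ℝ) (K : E → ℝ), 0 < β → β ≤ 2 →
      (∀ c : ℝ, 0 < c → ∀ x, K (c • x) = c ^ (-β) * K x) →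
      (∀ n ∈ latticeMirrorNormals (Fin 3), ∀ x, K ((ℝ ∙ n)ᗮ.reflection x) = K x) →
      EntireMeridianProfiles β K →
      ∀ (R : E ≃ₗᵢ[ℝ] E) (x : E), K (R x) = K x := by
  sorry

/-! ### Registered-stub aliases
`Registered.stub_X` is stub `X`'s statement under the registered stub's short name, so that the native skeleton
audit (`#h21_check_skeleton … stub_…`, run by `ledger skeleton check`) accepts the hypotheses of
`StableConeRPRigidity_of` as the registered obligations (hypothesis heads are matched by name). -/
namespace Registered

/-- Statement of registered stub S1. -/
abbrev stub_halfPlaneExtension : Prop := HalfPlaneExtensionLemma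
/-- Statement of registered stub S2. -/
abbrev stub_bernsteinCross : Prop := BoundedCrossLemma
/-- Statement of registered stub S3. -/
abbrev stub_grauertTube : Prop := UniformTubeLemma
/-- Statement of registered stub S4. -/
abbrev stub_meridianGapPinning : Prop := MeridianGapPinning
/-- Statement of registered stub S5. -/
abbrev stub_fourierExtinction : Prop := ModeExtinction

end Registered

/-! ## The composition (proved): S1 → S2 → S3 → S4 → S5 → crux, BY NAME -/

/-- **The skeleton closes the crux modulo the registered stubs.**  With `β = 3 - α`: the nine fins (S1 at each
lattice normal, nonzero by `ne_zero_of_mem_latticeMirrorNormals`), the tube (S3 fed with S2), entire meridian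
profiles (S4, which also receives the crux's own hypotheses), isotropy (S5).  The crux's inlined mirror set and RP
clause are `latticeMirrorNormals (Fin 3)` and `IsMirrorRPKernel` definitionally. -/
theorem StableConeRPRigidity_of (h1 : Registered.stub_halfPlaneExtension) (h2 : Registered.stub_bernsteinCross)
    (h3 : Registered.stub_grauertTube) (h4 : Registered.stub_meridianGapPinning)
    (h5 : Registered.stub_fourierExtinction) :
    Summit.CriticalPhenomena.Ising3DConformalLimit.Theses.PrecisionLaplacian.StableConeRPRigidity := by
  intro α Φ K hα1 hα2 hΦc hΦnn hΦpos hΦev hKc hKpos hhom hpot hmir R x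
  have hβ0 : 0 < 3 - α := by linarith
  have hβ2 : 3 - α ≤ 2 := by linarith
  have hhom' : ∀ c : ℝ, 0 < c → ∀ y : E, K (c • y) = c ^ (-(3 - α)) * K y := by
    intro c hc y
    rw [hhom c hc y, show -(3 - α) = α - 3 by ring]
  have hmir' : ∀ n ∈ latticeMirrorNormals (Fin 3),
      (∀ y, K ((ℝ ∙ n)ᗮ.reflection y) = K y) ∧ IsMirrorRPKernel n K :=
    fun n hn => hmir n hn
  have hinv : ∀ n ∈ latticeMirrorNormals (Fin 3), ∀ y, K ((ℝ ∙ n)ᗮ.reflection y) = K y :=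
    fun n hn => (hmir' n hn).1
  -- evenness of `K`: the three coordinate mirrors compose to `-1`
  have heven : ∀ y : E, K (-y) = K y := by
    intro y
    have h0 := hinv _ (single_mem_latticeMirrorNormals (show (0 : Fin 3) ≠ 1 by decide))
    have h1' := hinv _ (single_mem_latticeMirrorNormals (show (1 : Fin 3) ≠ 0 by decide))
    have h2' := hinv _ (single_mem_latticeMirrorNormals (show (2 : Fin 3) ≠ 0 by decide))
    have key : (ℝ ∙ EuclideanSpace.single (0 : Fin 3) (1 : ℝ))ᗮ.reflection
        ((ℝ ∙ EuclideanSpace.single (1 : Fin 3) (1 : ℝ))ᗮ.reflection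
          ((ℝ ∙ EuclideanSpace.single (2 : Fin 3) (1 : ℝ))ᗮ.reflection y)) = -y := by
      ext l
      simp only [reflection_single_apply, PiLp.neg_apply]
      fin_cases l <;> simp
    rw [← key, h0, h1', h2']
  have hfin : ∀ n ∈ latticeMirrorNormals (Fin 3), HalfPlaneExtension n K :=
    fun n hn => h1 n K (3 - α) (ne_zero_of_mem_latticeMirrorNormals hn) hβ0 hKc heven hhom'
      (hmir' n hn).1 (hmir' n hn).2
  have htube : TubeExtension (3 - α) K := h3 h2 (3 - α) K hβ0 hKc hhom' hinv hfin
  have hent : EntireMeridianProfiles (3 - α) K :=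
    h4 α Φ K hα1 hα2 hΦc hΦnn hΦpos hΦev hKc hKpos hhom hpot hmir' hfin htube
  exact h5 (3 - α) K hβ0 hβ2 hhom' hinv hent R x

/-- How the closed proof is obtained once the five stubs land (an `example`, so that `StableConeRPRigidity_of`
is the only theorem of this file concluding the crux). -/
example : Summit.CriticalPhenomena.Ising3DConformalLimit.Theses.PrecisionLaplacian.StableConeRPRigidity :=
  StableConeRPRigidity_of stub_halfPlaneExtension stub_bernsteinCross stub_grauertTube stub_meridianGapPinning
    stub_fourierExtinction

end Summit.CriticalPhenomena.Ising3DConformalLimit.Cruxes.StableConeRPRigidity.CrossTheoremAnalyticity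

end
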